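import Literature.Analysis.FluidPDE.KNSSTypeIIZoomIn
import Literature.Analysis.FluidPDE.KNSSTypeIRateMildProofs
import Literature.Analysis.FluidPDE.KNSSTypeIRateLimit
import Literature.Analysis.FluidPDE.KNSSTypeIRateLiouvilleHolds
import Literature.Analysis.FluidPDE.AncientMildCompactness
import Literature.Analysis.FluidPDE.BoundedMildSmoothRemainder
import Literature.Analysis.FluidPDE.NSLerayOseenRepresentation
import Literature.Analysis.FluidPDE.NSBoundedMildOseenRestart
import Literature.Analysis.FluidPDE.NSBoundedMildSmoothing
import Literature.Analysis.FluidPDE.KNSSAxisymmetricNoSwirlHolds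
import Summits.NavierStokesRegularity.NavierStokesRegularity.Theorems.CertifiedBlowupCertifiedBlowupAxisymBlowupSwirlPersists
import Summits.NavierStokesRegularity.NavierStokesRegularity.Theorems.CertifiedBlowupCertifiedBlowupAxisymBlowupSwirlOrderParameter
import HarnessLib

/-!
# The swirl-free blow-up limit of the KNSS sup-zoom is a constant multiple of `e_z`

Theorems file landed `--supports stmt-NavierStokesRegularity-0727` (crux `CertifiedBlowupAxisymBlowup`), line
`compact-amplification` (registered), sub-skeleton "axis-aware KNSS sup-zoom of a witness"
(`Cruxes/CertifiedBlowupAxisymBlowup/Lines/registered_zoom_probe.lean`), continuation lead c5.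
Stub G3 (`zoom_noSwirl_const`): a bounded, jointly continuous, ancient field `W` on
`(−∞, 0) × ℝ³` with weakly divergence-free slices, satisfying the Oseen integral identity
`W(t) = e^{(t−s)Δ} W(s) − B¹_s(W, W)(t)` pointwise for all `s < t < 0`, whose slices are
axisymmetric with no swirl, is `β • e_z` for one constant `β ∈ ℝ`. Assembled from proved tree
facts: the Oseen-mild field is a bounded ancient mild solution in duality form
(`isBoundedAncientMildSolution_of_oseen`); KNSS 2009, Theorem 5.2
(`knss_axisymmetric_no_swirl_holds`) makes every slice a.e. `β(t) • e_z`, continuity of the slices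
(`MeasureTheory.Measure.eq_of_ae_eq`) makes this hold everywhere, and KNSS 2009, Remark 6.1 in
the Oseen rendering (`KNSS2009_remark61`) makes `β` independent of `t`.

## References
* H. Koch, N. Nadirashvili, G. Seregin, V. Šverák, Acta Math. 203 (2009) 83–105 = arXiv:0709.3599, §4, Thm 5.2, Remark 6.1, §6. [KochNadirashviliSereginSverak2009]
-/

set_option linter.dupNamespace false

noncomputable section

open MeasureTheory Set Function Filter Topology Metric
open scoped NNReal ENNReal

namespace Summit.NavierStokesRegularity.NavierStokesRegularity.Theorems.CertifiedBlowupAxisymBlowup.CompactAmplification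

open Literature.Analysis Literature.Analysis.FluidPDE
open Summit.NavierStokesRegularity.NavierStokesRegularity.Theses.CertifiedBlowup

local notation "ℝ³" => EuclideanSpace ℝ (Fin 3)

/-- **Stub G3: an axisymmetric swirl-free bounded ancient Oseen-mild field is a constant multiple
of `e_z`.** Let `W : ℝ → ℝ³ → ℝ³` be jointly continuous and bounded on `(−∞, 0) × ℝ³`, with weakly
divergence-free slices, satisfying `W(t) = e^{(t−s)Δ} W(s) − B¹_s(W, W)(t)` pointwise for all
`s < t < 0`, and with every slice `W(t)`, `t < 0`, axisymmetric and swirl free. Then there is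
`β ∈ ℝ` with `W(t, x) = β e_z` for all `t < 0` and all `x`. Proof: `W` is a bounded ancient mild
solution in the tree's duality form (`isBoundedAncientMildSolution_of_oseen`), its slices are
continuous hence measurable, so KNSS 2009, Thm 5.2 (`knss_axisymmetric_no_swirl_holds`) gives
`W(t) = β(t) e_z` a.e., hence everywhere by continuity; KNSS 2009, Remark 6.1 for the Oseen
integral equation (`KNSS2009_remark61`) makes the spatial constant `W(t, 0)` independent of `t`.
[cite: KochNadirashviliSereginSverak2009, Thm 5.2 and Remark 6.1 (arXiv:0709.3599, pp. 9–11)] -/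
theorem zoom_noSwirl_const : ∀ (W : ℝ → ℝ³ → ℝ³),
    ContinuousOn (uncurry W) (Iio 0 ×ˢ univ) → (∃ K : ℝ, ∀ t < 0, ∀ x, ‖W t x‖ ≤ K) →
    (∀ t < 0, IsWeaklyDivFree (W t)) →
    (∀ s t : ℝ, s < t → t < 0 → ∀ x,
      W t x = UnboundedOperators.heatExtension (W s) (t - s) x - oseenDuhamel 1 s W W t x) →
    (∀ t < 0, IsAxisymmetric (W t)) → (∀ t < 0, HasNoSwirl (W t)) →
    ∃ β : ℝ, ∀ t < 0, ∀ x, W t x = β • eZ := by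
  intro W hcont hbdd hdiv hmild haxi hswirl
  -- the Oseen identity with the viscosity factor `1 * (t - s)` displayed
  have hmild' : ∀ s t : ℝ, s < t → t < 0 → ∀ x,
      W t x = UnboundedOperators.heatExtension (W s) (1 * (t - s)) x -
        oseenDuhamel 1 s W W t x := fun s t hst ht x => by
    rw [one_mul]
    exact hmild s t hst ht x
  -- KNSS's class: a bounded ancient mild solution in duality form
  have hW : IsBoundedAncientMildSolution 1 W :=
    isBoundedAncientMildSolution_of_oseen one_pos hcont hbdd hdiv hmild'
  -- the slices are continuous, hence measurable
  have hWc : ∀ t < 0, Continuous (W t) := fun t ht =>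
    hcont.comp_continuous (f := fun x : ℝ³ => (t, x)) (by fun_prop) fun x => ⟨ht, mem_univ _⟩
  have hmeas : ∀ t < 0, AEStronglyMeasurable (W t) volume := fun t ht =>
    (hWc t ht).aestronglyMeasurable
  -- KNSS Thm 5.2: every slice is a.e. `β(t) • e_z`, hence everywhere by continuity
  have hslice : ∀ t < 0, ∃ β : ℝ, ∀ x, W t x = β • eZ := by
    intro t ht
    obtain ⟨β, hβ⟩ := knss_axisymmetric_no_swirl_holds hW hmeas haxi hswirl t ht
    exact ⟨β, fun x => congrFun (Measure.eq_of_ae_eq hβ (hWc t ht) continuous_const) x⟩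
  -- so the slices are spatially constant: `W t x = W t 0`
  have hub : ∀ t < 0, ∀ x, W t x = W t 0 := by
    intro t ht x
    obtain ⟨β, hβ⟩ := hslice t ht
    rw [hβ x, hβ 0]
  -- Remark 6.1: the spatial constant is independent of time
  have htime : ∀ s t : ℝ, s < 0 → t < 0 → W s 0 = W t 0 :=
    KNSS2009_remark61 (b := fun t => W t 0) one_pos hub
      fun s t hst ht => Eventually.of_forall (hmild' s t hst ht)
  obtain ⟨β, hβ⟩ := hslice (-1) (by norm_num)
  refine ⟨β, fun t ht x => ?_⟩
  rw [hub t ht x, ← htime (-1) t (by norm_num) ht, hβ 0]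

end Summit.NavierStokesRegularity.NavierStokesRegularity.Theorems.CertifiedBlowupAxisymBlowup.CompactAmplification

end
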